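import Mathlib
import Summits.MatrixMultiplication.MatrixMultiplication.Theorems.GradedDesignFamily.Negative.SubfieldCellOrbits

/-!
# Free orbits of `φ(SL₂ k)` on `K²`: at most `q − 1`
# (crux `LevelGradedCohnUmans.GradedDesignFamily`, stmt-MatrixMultiplication-7610; negative side,
# line `quadratic-extension-level-one-cell`, stub S3 `stub_subfieldCell`)

HONEST FRAMING.  Support for DECIDING the finite cells `q = 4, 5` of S3 by theorem (the
cusp-form wall); not summit progress.

`subfieldCell_orbitReps`: for an ARBITRARY injective hom `φ : SL₂(k) →* GL₂(K)` with
`|K| = |k|²` there is a set `Reps ⊆ K²` of at most `|k| − 1` points such that every non-zero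
`w ∈ K²` is either a translate `φ(s) v` of some `v ∈ Reps`, or has stabiliser EXACTLY a conjugate
`{b u_x b⁻¹ : x ∈ k}` of the root group.

Count: the `q + 1` unipotent elements `s_c = [[1−c, c²], [−1, 1+c]]` (`c ∈ k`) and
`s_∞ = u_1` pairwise do not commute, so (stabilisers lying in abelian conjugates of `U`,
`subfieldCell_stab_le_conj`) their fixed lines `ker(φ(s_j) − 1)` — lines by
`fin_two_card_filter_mulVec_eq_zero` — are pairwise disjoint off `0`; this gives
`≥ (q+1)(|K| − 1)` non-free points, hence `≤ |K|² − 1 − (q+1)(|K| − 1) = (q − 1)·|SL₂(k)|` free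
points, i.e. at most `q − 1` free orbits (each of size `|SL₂(k)|`).

Sorry-free; axioms `propext`, `Classical.choice`, `Quot.sound`.
-/

set_option linter.dupNamespace false

open scoped BigOperators
open Matrix

namespace Summit.MatrixMultiplication.MatrixMultiplication.Theorems.GradedDesignFamily.Negative

variable {k K : Type} [Field k] [Fintype k] [DecidableEq k] [Field K] [Fintype K] [DecidableEq K]

/-- **Orbit dichotomy with a count.**  For `φ : SL₂(k) →* GL₂(K)` injective with `|K| = |k|²`
there is `Reps ⊆ K²`, `|Reps| ≤ |k| − 1`, such that every `w ≠ 0` is either `φ(s) v` for some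
`v ∈ Reps`, `s ∈ SL₂(k)`, or has stabiliser exactly `{b u_x b⁻¹ : x ∈ k}` for some `b`.
[folklore] -/
theorem subfieldCell_orbitReps
    (φ : Matrix.SpecialLinearGroup (Fin 2) k →* Matrix.GeneralLinearGroup (Fin 2) K)
    (hφ : Function.Injective φ) (hK : Fintype.card K = Fintype.card k ^ 2) :
    ∃ Reps : Finset (Fin 2 → K), Reps.card ≤ Fintype.card k - 1 ∧
      ∀ w : Fin 2 → K, w ≠ 0 →
        (∃ v ∈ Reps, ∃ s : Matrix.SpecialLinearGroup (Fin 2) k,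
          ((φ s : Matrix.GeneralLinearGroup (Fin 2) K) : Matrix (Fin 2) (Fin 2) K) *ᵥ v = w) ∨
        (∃ b : Matrix.SpecialLinearGroup (Fin 2) k, ∀ t : Matrix.SpecialLinearGroup (Fin 2) k,
          ((φ t : Matrix.GeneralLinearGroup (Fin 2) K) : Matrix (Fin 2) (Fin 2) K) *ᵥ w = w ↔
            ∃ x : k, t = b * ⟨!![(1 : k), x; 0, 1], sl2md_det_upper x⟩ * b⁻¹) := by
  classical
  set p := ringChar k with hp_def
  haveI hprime : Fact p.Prime := ⟨CharP.char_is_prime k p⟩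
  haveI hchark : CharP k p := ringChar.charP k
  set q := Fintype.card k with hq_def
  have hq1 : 1 < q := Fintype.one_lt_card
  -- the action through `φ`
  have hact : ∀ (s t : Matrix.SpecialLinearGroup (Fin 2) k) (w : Fin 2 → K),
      (φ (s * t)).val *ᵥ w = (φ s).val *ᵥ ((φ t).val *ᵥ w) := by
    intro s t w
    rw [map_mul, Units.val_mul, Matrix.mulVec_mulVec]
  have hact1 : ∀ w : Fin 2 → K, (φ 1).val *ᵥ w = w := by
    intro w
    rw [map_one, Units.val_one, Matrix.one_mulVec]
  have hcancel : ∀ (s : Matrix.SpecialLinearGroup (Fin 2) k) (w : Fin 2 → K),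
      (φ s⁻¹).val *ᵥ ((φ s).val *ᵥ w) = w := by
    intro s w
    rw [← hact, inv_mul_cancel, hact1]
  -- the `q + 1` unipotent elements `s_j`
  have hdetA : ∀ c : k, Matrix.det !![1 - c, c ^ 2; -1, 1 + c] = 1 := fun c => by
    simp [Matrix.det_fin_two_of]; ring
  let sj : Option k → Matrix.SpecialLinearGroup (Fin 2) k := fun j =>
    j.elim ⟨!![(1 : k), 1; 0, 1], sl2md_det_upper 1⟩ (fun c => ⟨!![1 - c, c ^ 2; -1, 1 + c], hdetA c⟩)
  have hs_ne : ∀ j, sj j ≠ 1 := by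
    intro j h
    cases j with
    | none =>
      have := congrArg (fun g : Matrix.SpecialLinearGroup (Fin 2) k =>
        (g : Matrix (Fin 2) (Fin 2) k) 0 1) h
      simp [sj] at this
    | some c =>
      have := congrArg (fun g : Matrix.SpecialLinearGroup (Fin 2) k =>
        (g : Matrix (Fin 2) (Fin 2) k) 1 0) h
      simp [sj] at this
  have hn_sq : ∀ j, ((sj j : Matrix (Fin 2) (Fin 2) k) - 1) * ((sj j : Matrix (Fin 2) (Fin 2) k) - 1) = 0 := by
    intro j
    cases j with
    | none =>
      ext i i'
      fin_cases i <;> fin_cases i' <;> simp [sj, Matrix.mul_apply, Fin.sum_univ_two, Matrix.one_apply]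
    | some c =>
      ext i i'
      fin_cases i <;> fin_cases i' <;>
        simp [sj, Matrix.mul_apply, Fin.sum_univ_two, Matrix.one_apply] <;> ring
  have hs_pow : ∀ j, sj j ^ p = 1 := by
    intro j
    apply Subtype.ext
    rw [Matrix.SpecialLinearGroup.coe_pow, Matrix.SpecialLinearGroup.coe_one]
    have e : (sj j : Matrix (Fin 2) (Fin 2) k) = 1 + ((sj j : Matrix (Fin 2) (Fin 2) k) - 1) := by
      abel
    rw [e, fin_two_one_add_pow _ (hn_sq j) p, CharP.cast_eq_zero, zero_smul, add_zero]
  -- the `s_j` pairwise do not commute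
  have hs_comm : ∀ j j', sj j * sj j' = sj j' * sj j → j = j' := by
    have hss : ∀ c d : k, sj (some c) * sj (some d) = sj (some d) * sj (some c) → c = d := by
      intro c d h
      have hm := congrArg (fun g : Matrix.SpecialLinearGroup (Fin 2) k =>
        (g : Matrix (Fin 2) (Fin 2) k)) h
      simp only [Matrix.SpecialLinearGroup.coe_mul] at hm
      have e00 : (1 - c) * (1 - d) + c ^ 2 * (-1) = (1 - d) * (1 - c) + d ^ 2 * (-1) := by
        have := congr_fun (congr_fun hm 0) 0
        simpa [sj, Matrix.mul_apply, Fin.sum_univ_two] using this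
      have e10 : (-1) * (1 - d) + (1 + c) * (-1) = (-1) * (1 - c) + (1 + d) * (-1) := by
        have := congr_fun (congr_fun hm 1) 0
        simpa [sj, Matrix.mul_apply, Fin.sum_univ_two] using this
      have hcd : (c - d) ^ 2 = 0 := by linear_combination (-1 : k) * e00 + d * e10
      exact sub_eq_zero.1 (pow_eq_zero_iff two_ne_zero |>.1 hcd)
    have hns : ∀ c : k, sj none * sj (some c) ≠ sj (some c) * sj none := by
      intro c h
      have hm := congrArg (fun g : Matrix.SpecialLinearGroup (Fin 2) k =>
        (g : Matrix (Fin 2) (Fin 2) k)) h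
      simp only [Matrix.SpecialLinearGroup.coe_mul] at hm
      have := congr_fun (congr_fun hm 0) 0
      simp [sj, Matrix.mul_apply, Fin.sum_univ_two] at this
    intro j j' h
    cases j with
    | none =>
      cases j' with
      | none => rfl
      | some c => exact absurd h (hns c)
    | some c =>
      cases j' with
      | none => exact absurd h.symm (hns c)
      | some d => rw [hss c d h]
  -- `N_j = φ(s_j) - 1 ≠ 0`, square-zero
  have hN_ne : ∀ j, (φ (sj j)).val - 1 ≠ 0 := by
    intro j hz
    apply hs_ne j
    apply hφ
    rw [map_one]
    ext1
    rw [Units.val_one]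
    exact sub_eq_zero.1 hz
  have hN_sq : ∀ j, ((φ (sj j)).val - 1) * ((φ (sj j)).val - 1) = 0 := fun j =>
    subfieldCell_sub_one_sq_of_pow_char φ hK (sj j) (hs_pow j)
  -- punctured fixed lines
  let PL : Option k → Finset (Fin 2 → K) := fun j =>
    (Finset.univ.filter fun v : Fin 2 → K => ((φ (sj j)).val - 1) *ᵥ v = 0).erase 0
  have hPL_card : ∀ j, (PL j).card = Fintype.card K - 1 := by
    intro j
    simp only [PL]
    rw [Finset.card_erase_of_mem, fin_two_card_filter_mulVec_eq_zero _ (hN_ne j) (hN_sq j)]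
    simp
  have hPL_mem : ∀ j v, v ∈ PL j ↔ v ≠ 0 ∧ (φ (sj j)).val *ᵥ v = v := by
    intro j v
    simp only [PL, Finset.mem_erase, Finset.mem_filter, Finset.mem_univ, true_and,
      Matrix.sub_mulVec, Matrix.one_mulVec, sub_eq_zero]
  -- non-free and free points
  let NZ : Finset (Fin 2 → K) := Finset.univ.filter fun v : Fin 2 → K => v ≠ 0
  let Free : Finset (Fin 2 → K) := NZ.filter fun v =>
    ∀ t : Matrix.SpecialLinearGroup (Fin 2) k, (φ t).val *ᵥ v = v → t = 1
  let NonFree : Finset (Fin 2 → K) := NZ.filter fun v =>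
    ¬ ∀ t : Matrix.SpecialLinearGroup (Fin 2) k, (φ t).val *ᵥ v = v → t = 1
  have hNZ_card : NZ.card = Fintype.card K ^ 2 - 1 := by
    simp only [NZ, Finset.filter_ne', Finset.card_erase_of_mem (Finset.mem_univ _),
      Finset.card_univ, Fintype.card_fun, Fintype.card_fin]
  have hsplit : Free.card + NonFree.card = Fintype.card K ^ 2 - 1 := by
    rw [← hNZ_card]
    exact Finset.card_filter_add_card_filter_not _
  have hPL_sub : ∀ j, PL j ⊆ NonFree := by
    intro j v hv
    rw [hPL_mem] at hv
    simp only [NonFree, NZ, Finset.mem_filter, Finset.mem_univ, true_and]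
    exact ⟨hv.1, fun h => hs_ne j (h (sj j) hv.2)⟩
  have hPL_disj : ∀ j j', j ≠ j' → Disjoint (PL j) (PL j') := by
    intro j j' hjj'
    rw [Finset.disjoint_left]
    intro v hv hv'
    rw [hPL_mem] at hv hv'
    obtain ⟨b, hb⟩ := subfieldCell_stab_le_conj φ hφ hK v hv.1
    obtain ⟨x, hx⟩ := hb (sj j) hv.2
    obtain ⟨y, hy⟩ := hb (sj j') hv'.2
    apply hjj'
    apply hs_comm
    rw [hx, hy]
    have e1 : ∀ x y : k, b * ⟨!![(1 : k), x; 0, 1], sl2md_det_upper x⟩ * b⁻¹ *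
        (b * ⟨!![(1 : k), y; 0, 1], sl2md_det_upper y⟩ * b⁻¹) =
        b * (⟨!![(1 : k), x; 0, 1], sl2md_det_upper x⟩ * ⟨!![(1 : k), y; 0, 1], sl2md_det_upper y⟩) * b⁻¹ := by
      intro x y
      group
    rw [e1, e1, sl2md_upper_mul, sl2md_upper_mul, add_comm]
  -- the count of non-free points
  have hNonFree : (q + 1) * (Fintype.card K - 1) ≤ NonFree.card := by
    have hbU : (Finset.univ.biUnion PL).card = ∑ j, (PL j).card :=
      Finset.card_biUnion fun j _ j' _ hjj' => hPL_disj j j' hjj'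
    calc (q + 1) * (Fintype.card K - 1) = ∑ j : Option k, (PL j).card := by
          rw [Finset.sum_congr rfl fun j _ => hPL_card j, Finset.sum_const, Finset.card_univ,
            Fintype.card_option, smul_eq_mul]
      _ = (Finset.univ.biUnion PL).card := hbU.symm
      _ ≤ NonFree.card := Finset.card_le_card (Finset.biUnion_subset.2 fun j _ => hPL_sub j)
  have hSL : Nat.card (Matrix.SpecialLinearGroup (Fin 2) k) = q * (q ^ 2 - 1) :=
    Literature.NumberTheory.GaloisRepresentations.SL2Wreath.natCard_specialLinearGroup_fin_two
  have hFree : Free.card ≤ (q - 1) * Nat.card (Matrix.SpecialLinearGroup (Fin 2) k) := by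
    rw [hSL]
    rw [hK] at hsplit hNonFree
    have hq2 : 1 ≤ q ^ 2 := Nat.one_le_pow _ _ (by omega)
    have hq4 : 1 ≤ (q ^ 2) ^ 2 := Nat.one_le_pow _ _ hq2
    have key : Free.card + (q + 1) * (q ^ 2 - 1) ≤ (q ^ 2) ^ 2 - 1 := by omega
    zify [hq2, hq4, hq1.le] at key ⊢
    have e : ((q : ℤ) ^ 2) ^ 2 - 1 - (q + 1) * (q ^ 2 - 1) = (q - 1) * (q * (q ^ 2 - 1)) := by ring
    linarith
  -- orbits of free points
  let Orb : (Fin 2 → K) → Finset (Fin 2 → K) := fun w =>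
    Finset.univ.image fun s : Matrix.SpecialLinearGroup (Fin 2) k => (φ s).val *ᵥ w
  have hFree_mem : ∀ w, w ∈ Free ↔ w ≠ 0 ∧
      ∀ t : Matrix.SpecialLinearGroup (Fin 2) k, (φ t).val *ᵥ w = w → t = 1 := by
    intro w
    simp only [Free, NZ, Finset.mem_filter, Finset.mem_univ, true_and]
  have hOrb_card : ∀ w ∈ Free, (Orb w).card = Nat.card (Matrix.SpecialLinearGroup (Fin 2) k) := by
    intro w hw
    rw [hFree_mem] at hw
    rw [Nat.card_eq_fintype_card, ← Finset.card_univ]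
    refine Finset.card_image_of_injective _ fun s s' h => ?_
    have h1 := congrArg (fun u => (φ s'⁻¹).val *ᵥ u) h
    rw [hcancel, ← hact] at h1
    exact (inv_mul_eq_one.1 (hw.2 _ h1)).symm
  have hOrb_sub : ∀ w ∈ Free, Orb w ⊆ Free := by
    intro w hw v hv
    rw [hFree_mem] at hw
    obtain ⟨s, -, rfl⟩ := Finset.mem_image.1 hv
    rw [hFree_mem]
    refine ⟨fun h0 => hw.1 ?_, fun t ht => ?_⟩
    · have := congrArg (fun u => (φ s⁻¹).val *ᵥ u) h0
      rwa [hcancel, Matrix.mulVec_zero] at this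
    · have h1 : (φ (s⁻¹ * t * s)).val *ᵥ w = w := by
        rw [hact, hact, ht, hcancel]
      have h2 := hw.2 _ h1
      calc t = s * (s⁻¹ * t * s) * s⁻¹ := by group
        _ = 1 := by rw [h2]; group
  have hOrb_eq : ∀ (w : Fin 2 → K) (g : Matrix.SpecialLinearGroup (Fin 2) k),
      Orb ((φ g).val *ᵥ w) = Orb w := by
    intro w g
    ext v
    simp only [Orb, Finset.mem_image, Finset.mem_univ, true_and]
    constructor
    · rintro ⟨s, hs⟩
      exact ⟨s * g, by rw [hact]; exact hs⟩
    · rintro ⟨s, hs⟩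
      exact ⟨s * g⁻¹, by rw [hact, hcancel]; exact hs⟩
  let Orbs : Finset (Finset (Fin 2 → K)) := Free.image Orb
  have hOrbs_disj : ∀ O ∈ Orbs, ∀ O' ∈ Orbs, O ≠ O' → Disjoint O O' := by
    intro O hO O' hO' hne
    obtain ⟨w, -, rfl⟩ := Finset.mem_image.1 hO
    obtain ⟨w', -, rfl⟩ := Finset.mem_image.1 hO'
    rw [Finset.disjoint_left]
    intro v hv hv'
    apply hne
    obtain ⟨s, -, rfl⟩ := Finset.mem_image.1 hv
    obtain ⟨s', -, hs'⟩ := Finset.mem_image.1 hv'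
    -- `w' = φ(s'⁻¹ s) w`
    have hw' : w' = (φ (s'⁻¹ * s)).val *ᵥ w := by
      rw [hact, ← hs', hcancel]
    rw [hw', hOrb_eq]
  have hOrbs_card : Orbs.card * Nat.card (Matrix.SpecialLinearGroup (Fin 2) k) ≤ Free.card := by
    have h1 : (Orbs.biUnion id).card = ∑ O ∈ Orbs, (id O).card := Finset.card_biUnion hOrbs_disj
    have h2 : ∑ O ∈ Orbs, (id O).card = ∑ O ∈ Orbs, Nat.card (Matrix.SpecialLinearGroup (Fin 2) k) := by
      refine Finset.sum_congr rfl fun O hO => ?_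
      obtain ⟨w, hw, rfl⟩ := Finset.mem_image.1 hO
      exact hOrb_card w hw
    rw [Finset.sum_const, smul_eq_mul] at h2
    rw [← h2, ← h1]
    refine Finset.card_le_card (Finset.biUnion_subset.2 fun O hO => ?_)
    obtain ⟨w, hw, rfl⟩ := Finset.mem_image.1 hO
    exact hOrb_sub w hw
  have hOrbs : Orbs.card ≤ q - 1 :=
    Nat.le_of_mul_le_mul_right (hOrbs_card.trans hFree) Nat.card_pos
  -- representatives
  let rep : Finset (Fin 2 → K) → (Fin 2 → K) := fun O => if h : O.Nonempty then h.choose else 0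
  refine ⟨Orbs.image rep, Finset.card_image_le.trans hOrbs, fun w hw => ?_⟩
  by_cases hfree : ∀ t : Matrix.SpecialLinearGroup (Fin 2) k, (φ t).val *ᵥ w = w → t = 1
  · left
    have hwF : w ∈ Free := (hFree_mem w).2 ⟨hw, hfree⟩
    have hO : (Orb w).Nonempty := ⟨w, Finset.mem_image.2 ⟨1, Finset.mem_univ _, hact1 w⟩⟩
    have hrep : rep (Orb w) ∈ Orb w := by
      simp only [rep, dif_pos hO]
      exact hO.choose_spec
    obtain ⟨s, -, hs⟩ := Finset.mem_image.1 hrep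
    refine ⟨rep (Orb w), Finset.mem_image_of_mem _ (Finset.mem_image_of_mem _ hwF), s⁻¹, ?_⟩
    rw [← hs, hcancel]
  · right
    push Not at hfree
    obtain ⟨t, ht, ht1⟩ := hfree
    exact subfieldCell_stab_eq_conj φ hφ hK w hw t ht1 ht

end Summit.MatrixMultiplication.MatrixMultiplication.Theorems.GradedDesignFamily.Negative
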